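import Summits.BirchSwinnertonDyer.BirchSwinnertonDyer.Theorems.UniversalToricDescentResidualLinkTransport
import Summits.BirchSwinnertonDyer.BirchSwinnertonDyer.Theorems.UniversalToricDescentResidualSelmerLocal
import Summits.BirchSwinnertonDyer.BirchSwinnertonDyer.Theorems.UniversalToricDescentResidualSelmerTransport
import Summits.BirchSwinnertonDyer.Rank1Residual.X2.GreenbergVatsalUnramifiedAway
import HarnessLib

/-!
# The `Φ^M`-transport of the two-sided layer count: the residual Selmer group

Support file for crux `stmt-BirchSwinnertonDyer-24737` (`TwinAlgMuZeroAtThree`, line `beta-road` v5, port stub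
`stub_residualLinkMult`), companion of `…ResidualLinkTransport` (T1, T2). Here (T3): along the abstract Shapiro package
`(Φ^M, Φ, hdict, hkum)` at the residual level `E[p]`, `(Φ^M)⁻¹` embeds Greenberg–Vatsal's strict non-primitive residual Selmer
group `R = S^{S₀,str}_{E[p]}(K̄^U)` for Castella's data (strict at `𝔭′`, relaxed at `𝔭`) into the field-world group
`KO_L(P ∪ ∞ ∪ T) ∩ ⋂_{w∈P′} ker loc_w` (`P ⊇` places of `L` over `𝔭`, `T ⊇` places over `S₀`, `P′ ⊆` places over `𝔭′`):

* at `w ∣ 𝔭′`: the strict condition `conj_σ r ↦ 0 ∈ H¹(U ∩ D_𝔭′, E[p])` (all `σ`) is `loc_w ((Φ^M)⁻¹ r) = 0` for every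
  `w ∣ 𝔭′` (vanishing dictionary), in particular Kummer there;
* at a good `w ∤ p` outside `S₀` (inertia `I_u ≤ U`): unramified ⟹ `ι(conj_σ r)` locally trivial in `H¹(U, E[p^∞])`
  (`…ResidualSelmerLocal.torsionToPrimaryH1Sub_mem_awayKer_of_mem_unramifiedKer`, "`ℋ^ur_w(E[p^∞]) = 0`") ⟹ classical
  (`awayKer_le_localKerOver`) ⟹ Kummer at every `w ∣ u` (Kummer dictionary);
* at `P ∪ T ∪ ∞`: no condition.

Hence `R` is finite and `#R ≤ #(KO_L(P ∪ ∞ ∪ T) ∩ ⋂_{w∈P′} ker loc_w)` (`finite_and_natCard_datumStrictSelmer_le`), the third input of the chain feeding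
`…ResidualLinkOfLayerCount.residual_finite_of_twoSidedLayerCount`.

References: Greenberg–Vatsal, Invent. Math. 142 (2000), §2 pp. 15–17, 20; Castella, Math. Ann. (2018) §2.1–2.2;
Greenberg, LNM 1716 (1999), §2–3.
-/

set_option linter.dupNamespace false
set_option autoImplicit false

noncomputable section
open scoped Classical
open CategoryTheory Field NumberField IsDedekindDomain Function
open Literature.NumberTheory.EllipticCurves Literature.NumberTheory.EllipticCurves.GreenbergSelmer
open Literature.NumberTheory.GaloisRepresentations
open Literature.NumberTheory.GaloisRepresentations.DiscreteGaloisModule (SelmerStructure)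
open Literature.NumberTheory.GaloisCohomology
open scoped ContRepresentation
open scoped NumberField.LiesOver

namespace Summit.BirchSwinnertonDyer.BirchSwinnertonDyer.Theorems.UniversalToricDescentResidualLinkTransport

open Summit.BirchSwinnertonDyer.Rank1Residual.X11b.KummerPT Summit.BirchSwinnertonDyer.Rank1Residual.X11b.LocBridge
open Summit.BirchSwinnertonDyer.Rank1Residual.X11b.SelmerLevelBound
open Summit.BirchSwinnertonDyer.Rank1Residual.X11b
open Summit.BirchSwinnertonDyer.BirchSwinnertonDyer.Theorems.UniversalToricDescentRelaxedDualTransfer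
open Summit.BirchSwinnertonDyer.BirchSwinnertonDyer.Theorems.UniversalToricDescentTwoSidedLayerCountPT
open Summit.BirchSwinnertonDyer.BirchSwinnertonDyer.Theorems.UniversalToricDescentResidualSelmer
open Summit.BirchSwinnertonDyer.BirchSwinnertonDyer.Theorems.UniversalToricDescentResidualSelmerLocal

variable {K : Type} [Field K] [NumberField K] (W : WeierstrassCurve K) [W.IsElliptic] (p : ℕ) [hp : Fact p.Prime]
  (L : Type) [Field L] [NumberField L] [Algebra K L]
  (U : Subgroup (absoluteGaloisGroup K)) [U.Normal]
  (ΦM : galoisCohomology ((W.baseChange L).torsionGaloisModule ((p : ℕ) : ℤ)) 1 →+ subgroupH1 U (W.geomTorsion ((p : ℕ) : ℤ)))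
  (Φ : galoisCohomology ((W.baseChange L).torsionGaloisModule ((p : ℕ) : ℤ)) 1 →+ W.subgroupH1 p U)
  (hΦ : ∀ z, Φ z = W.torsionToPrimaryH1Sub p U (ΦM z)) (hbij : Function.Bijective ΦM)
  (hdict : ∀ (u : HeightOneSpectrum (𝓞 K)) (z : galoisCohomology ((W.baseChange L).torsionGaloisModule ((p : ℕ) : ℤ)) 1),
    (∀ w : HeightOneSpectrum (𝓞 L), w.asIdeal.LiesOver u.asIdeal →
      galoisCohomology.localization ((W.baseChange L).torsionGaloisModule ((p : ℕ) : ℤ)) (Sum.inr w) 1 z = 0) ↔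
    ∀ σ : absoluteGaloisGroup K,
      conjH1 U (W.geomTorsion ((p : ℕ) : ℤ)) σ (ΦM z) ∈ awayKer U (W.geomTorsion ((p : ℕ) : ℤ)) u)
  (hkum : ∀ (u : HeightOneSpectrum (𝓞 K)) (x : galoisCohomology ((W.baseChange L).torsionGaloisModule ((p : ℕ) : ℤ)) 1),
    (∀ w : HeightOneSpectrum (𝓞 L), w.asIdeal.LiesOver u.asIdeal →
      galoisCohomology.res ((W.baseChange L).torsionGaloisModule ((p : ℕ) : ℤ)) (w.adicCompletion L) 1 x ∈
        (W.baseChange L).kummerLocalConditionAt ((p : ℕ) : ℤ) (w.adicCompletion L)) ↔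
    ∀ σ : absoluteGaloisGroup K, W.conjH1 p U σ (Φ x) ∈ W.localKerOver p U (u.adicCompletion K))

include hΦ hbij hdict hkum in
/-- **(T3) `#S^{S₀,str}_{E[p]}(K̄^U) ≤ #(KO_L(P ∪ ∞ ∪ T) ∩ ⋂_{w∈P′} ker loc_w)`** (Castella's data: strict at `𝔭′`, relaxed
at `𝔭`; every place of `K` above `p` other than `𝔭′` is `𝔭`; good reduction and inertia `≤ U` at the places outside `S₀ ∪ {v ∣ p}`):
`(Φ^M)⁻¹` maps the residual strict Selmer group injectively into the field-world group — strictness at `𝔭′` becomes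
`loc_w = 0` for `w ∣ 𝔭′` (vanishing dictionary), unramified at good `u ∤ p` becomes Kummer at every `w ∣ u`
("`ℋ^ur(E[p^∞]) = 0`" and the Kummer dictionary), and nothing is asked over `P ∪ T ∪ ∞`.
[cite: GreenbergVatsal2000, §2 pp. 15–17, 20] [cite: Castella2018, §2.1–2.2 (arXiv:1704.06608 p. 5)]
[cite: GreenbergLNM1716, §2 (pp. 62–63), §3 Lemma 3.3] -/
theorem finite_and_natCard_datumStrictSelmer_le (𝔭 𝔭' : HeightOneSpectrum (𝓞 K)) (h𝔭' : ((p : ℕ) : 𝓞 K) ∈ 𝔭'.asIdeal)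
    (S₀ : Finset (HeightOneSpectrum (𝓞 K)))
    (hsplit : ∀ u : HeightOneSpectrum (𝓞 K), ((p : ℕ) : 𝓞 K) ∈ u.asIdeal → u ≠ 𝔭' → u = 𝔭)
    (hgood : ∀ u : HeightOneSpectrum (𝓞 K), u ∉ S₀ → ((p : ℕ) : 𝓞 K) ∉ u.asIdeal → W.HasGoodReductionAt u)
    (hIU : ∀ u : HeightOneSpectrum (𝓞 K), u ∉ S₀ → ((p : ℕ) : 𝓞 K) ∉ u.asIdeal →
      (adicCompletionPrime K u).inertia (absoluteGaloisGroup K) ≤ U)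
    (P T P' : Finset (HeightOneSpectrum (𝓞 L))) (hP : ∀ w, w.under (𝓞 K) = 𝔭 → w ∈ P)
    (hT : ∀ w, w.under (𝓞 K) ∈ S₀ → w ∈ T) (hP' : ∀ w, w ∈ P' → w.under (𝓞 K) = 𝔭') :
    Finite ↥(GreenbergVatsal2000.datumStrictSelmer U (↥(W.geomTorsion (p : ℤ))) p
        (AcSelmer.bdpData _ p 𝔭') (↑S₀ : Set (HeightOneSpectrum (𝓞 K)))) ∧
    Nat.card ↥(GreenbergVatsal2000.datumStrictSelmer U (↥(W.geomTorsion (p : ℤ))) p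
        (AcSelmer.bdpData _ p 𝔭') (↑S₀ : Set (HeightOneSpectrum (𝓞 K)))) ≤
      Nat.card ↥((kummerRelaxed (W.baseChange L) p
          ((P.image Sum.inr ∪ Finset.univ.image Sum.inl) ∪ T.image Sum.inr)).selmerGroup ⊓
        ⨅ w ∈ P', (galoisCohomology.localization ((W.baseChange L).torsionGaloisModule ((p : ℕ) : ℤ))
          (Sum.inr w) 1).ker) := by
  haveI : NeZero p := ⟨hp.out.ne_zero⟩
  set A : Finset (Place L) := (P.image Sum.inr ∪ Finset.univ.image Sum.inl) ∪ T.image Sum.inr with hA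
  set M : Type := ↥(W.geomTorsion (p : ℤ)) with hM
  set R := GreenbergVatsal2000.datumStrictSelmer U M p (AcSelmer.bdpData _ p 𝔭') (↑S₀ : Set (HeightOneSpectrum (𝓞 K)))
    with hR
  set X := (kummerRelaxed (W.baseChange L) p A).selmerGroup ⊓
    ⨅ w ∈ P', (galoisCohomology.localization ((W.baseChange L).torsionGaloisModule ((p : ℕ) : ℤ)) (Sum.inr w) 1).ker
    with hX
  -- the target is finite
  haveI : Finite ↥(kummerRelaxed (W.baseChange L) p A).selmerGroup := by
    rw [selmerGroup_kummerRelaxed]; exact finite_kummerOutside _ _ _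
  haveI : Finite ↥X := Finite.of_injective _ (AddSubgroup.inclusion_injective (inf_le_left : X ≤ _))
  let e := AddEquiv.ofBijective ΦM hbij
  -- strictness at `𝔭′` ⟹ local vanishing at every `w ∣ 𝔭′` of the preimage
  have hvan : ∀ r : subgroupH1 U M, r ∈ R → ∀ w : HeightOneSpectrum (𝓞 L), w.under (𝓞 K) = 𝔭' →
      galoisCohomology.localization ((W.baseChange L).torsionGaloisModule ((p : ℕ) : ℤ)) (Sum.inr w) 1 (e.symm r) = 0 := by
    intro r hr w hw
    rw [GreenbergVatsal2000.mem_datumStrictSelmer_iff] at hr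
    have hstr : ∀ σ : absoluteGaloisGroup K, conjH1 U M σ (ΦM (e.symm r)) ∈ awayKer U M 𝔭' := by
      intro σ
      rw [apply_ofBijective_symm W p L U ΦM hbij r]
      have h := hr.2 𝔭' h𝔭' σ
      rw [AcSelmer.bdpData_self, mem_strictKer_strictDatum_iff] at h
      exact h
    exact (hdict 𝔭' (e.symm r)).mpr hstr w ((liesOver_iff_under_eq w 𝔭').mpr hw)
  -- the preimage of a residual strict class lies in `X`
  have hmem : ∀ r : ↥R, e.symm (r : subgroupH1 U M) ∈ X := by
    rintro ⟨r, hr⟩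
    have hr' := hr
    rw [GreenbergVatsal2000.mem_datumStrictSelmer_iff] at hr'
    refine AddSubgroup.mem_inf.mpr ⟨?_, ?_⟩
    · rw [SelmerStructure.mem_selmerGroup_iff]
      rintro (w | w)
      · have hw : (Sum.inl w : Place L) ∈ A :=
          Finset.mem_union_left _ (Finset.mem_union_right _ (Finset.mem_image_of_mem Sum.inl (Finset.mem_univ w)))
        rw [kummerRelaxed_of_mem _ _ _ hw]
        exact AddSubgroup.mem_top _
      · by_cases hw : (Sum.inr w : Place L) ∈ A
        · rw [kummerRelaxed_of_mem _ _ _ hw]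
          exact AddSubgroup.mem_top _
        · rw [kummerRelaxed_of_not_mem _ _ _ hw]
          -- `u := w ∩ K` is neither `𝔭` nor in `S₀`
          have hu𝔭 : w.under (𝓞 K) ≠ 𝔭 := fun h ↦
            hw (Finset.mem_union_left _ (Finset.mem_union_left _ (Finset.mem_image_of_mem Sum.inr (hP w h))))
          have huS : w.under (𝓞 K) ∉ S₀ := fun h ↦
            hw (Finset.mem_union_right _ (Finset.mem_image_of_mem Sum.inr (hT w h)))
          by_cases hpu : ((p : ℕ) : 𝓞 K) ∈ (w.under (𝓞 K)).asIdeal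
          · -- then `u = 𝔭′`: the preimage vanishes at `w`
            have hu : w.under (𝓞 K) = 𝔭' := by
              by_contra hne
              exact hu𝔭 (hsplit _ hpu hne)
            have h0 := hvan r hr w hu
            change galoisCohomology.localization ((W.baseChange L).torsionGaloisModule ((p : ℕ) : ℤ)) (Sum.inr w) 1
              (e.symm r) ∈ _
            rw [h0]
            exact AddSubgroup.zero_mem _
          · -- good place outside `S₀`: unramified ⟹ `ι` locally trivial ⟹ classical ⟹ Kummer at every `w ∣ u`
            have hcl : ∀ σ : absoluteGaloisGroup K, W.conjH1 p U σ (Φ (e.symm r)) ∈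
                W.localKerOver p U ((w.under (𝓞 K)).adicCompletion K) := by
              intro σ
              rw [hΦ, apply_ofBijective_symm W p L U ΦM hbij r, WeierstrassCurve.conjH1_torsionToPrimaryH1Sub]
              exact Summit.BirchSwinnertonDyer.Rank1Residual.X2.GreenbergVatsalUnramifiedAway.awayKer_le_localKerOver
                (v := w.under (𝓞 K)) (W := W) (p := p) U
                (torsionToPrimaryH1Sub_mem_awayKer_of_mem_unramifiedKer W p hpu (hgood _ huS hpu) (hIU _ huS hpu)
                  ((GreenbergVatsal2000.mem_unramifiedOutside_iff _).mp hr'.1 _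
                    (fun h ↦ huS (Finset.mem_coe.mp h)) hpu σ))
            exact (hkum (w.under (𝓞 K)) (e.symm r)).mpr hcl w
              (Literature.NumberTheory.GaloisRepresentations.liesOver_under w)
    · rw [AddSubgroup.mem_iInf]
      intro w
      rw [AddSubgroup.mem_iInf]
      intro hw
      rw [AddMonoidHom.mem_ker]
      exact hvan r hr w (hP' w hw)
  let f : ↥R → ↥X := fun r ↦ ⟨e.symm (r : subgroupH1 U M), hmem r⟩
  have hf : Function.Injective f := fun x y hxy ↦ by
    have h : e.symm (x : subgroupH1 U M) = e.symm (y : subgroupH1 U M) := congrArg Subtype.val hxy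
    exact Subtype.ext (e.symm.injective h)
  exact ⟨Finite.of_injective f hf, Nat.card_le_card_of_injective f hf⟩

include hΦ hbij hdict hkum in
/-- **The transported two-sided layer count.** For `K`, `L` totally complex, Castella's residual data at `(𝔭, 𝔭′)`
(every place above `p` other than `𝔭′` is `𝔭`; good reduction and inertia `≤ U` off `S₀ ∪ {v ∣ p}`), and the place sets
`P`, `T`, `P′` of `L` over `𝔭`, `S₀`, `𝔭′`: a field-world Poitou–Tate count
`#(KO_L(P ∪ ∞ ∪ T) ∩ ⋂_{P′} ker loc) · #(KS_L(∞)/KS_L(∞ ∪ P)) · #(KS_L(∞)/KS_L(∞ ∪ P′)) ≤ #KO_L(∞) · B`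
(`…RelaxedStrictMixedCount` with its local factors bounded by `B`) transports along `(Φ^M, Φ)` to the `Γ_K`-world count
`#R(U) · #(S ⧸ S ∩ Z_𝔭) · #(S ⧸ S ∩ Z_𝔭′) ≤ #S · B` (with `R(U)` finite) consumed by `…ResidualLinkOfLayerCount.residual_finite_of_twoSidedLayerCount`
(T3 · T2 · T2 ≤ field count ≤ T1). [cite: GreenbergLNM1716, §2 (pp. 62–63), §3] [cite: GreenbergVatsal2000, §2 pp. 15–17, 20]
[cite: MilneADT2006, Ch. I, Thm. 4.10 and Lemma 6.15] -/
theorem finite_and_natCard_residual_mul_quotients_le (hL : ∀ w : InfinitePlace L, w.IsComplex) (hK : ∀ w : InfinitePlace K, w.IsComplex)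
    (𝔭 𝔭' : HeightOneSpectrum (𝓞 K)) (h𝔭' : ((p : ℕ) : 𝓞 K) ∈ 𝔭'.asIdeal)
    (S₀ : Finset (HeightOneSpectrum (𝓞 K)))
    (hsplit : ∀ u : HeightOneSpectrum (𝓞 K), ((p : ℕ) : 𝓞 K) ∈ u.asIdeal → u ≠ 𝔭' → u = 𝔭)
    (hgood : ∀ u : HeightOneSpectrum (𝓞 K), u ∉ S₀ → ((p : ℕ) : 𝓞 K) ∉ u.asIdeal → W.HasGoodReductionAt u)
    (hIU : ∀ u : HeightOneSpectrum (𝓞 K), u ∉ S₀ → ((p : ℕ) : 𝓞 K) ∉ u.asIdeal →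
      (adicCompletionPrime K u).inertia (absoluteGaloisGroup K) ≤ U)
    (P T P' : Finset (HeightOneSpectrum (𝓞 L))) (hP : ∀ w, w ∈ P ↔ w.under (𝓞 K) = 𝔭)
    (hT : ∀ w, w ∈ T ↔ w.under (𝓞 K) ∈ S₀) (hP' : ∀ w, w ∈ P' ↔ w.under (𝓞 K) = 𝔭') (B : ℕ)
    (hPT : Nat.card ↥((kummerRelaxed (W.baseChange L) p
          ((P.image Sum.inr ∪ Finset.univ.image Sum.inl) ∪ T.image Sum.inr)).selmerGroup ⊓
        ⨅ w ∈ P', (galoisCohomology.localization ((W.baseChange L).torsionGaloisModule ((p : ℕ) : ℤ))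
          (Sum.inr w) 1).ker) *
      Nat.card (↥(kummerStrict (W.baseChange L) p (Finset.univ.image Sum.inl)).selmerGroup ⧸
        ((kummerStrict (W.baseChange L) p (Finset.univ.image Sum.inl ∪ P.image Sum.inr)).selmerGroup).addSubgroupOf
          (kummerStrict (W.baseChange L) p (Finset.univ.image Sum.inl)).selmerGroup) *
      Nat.card (↥(kummerStrict (W.baseChange L) p (Finset.univ.image Sum.inl)).selmerGroup ⧸
        ((kummerStrict (W.baseChange L) p (Finset.univ.image Sum.inl ∪ P'.image Sum.inr)).selmerGroup).addSubgroupOf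
          (kummerStrict (W.baseChange L) p (Finset.univ.image Sum.inl)).selmerGroup) ≤
      Nat.card ↥(kummerRelaxed (W.baseChange L) p (Finset.univ.image Sum.inl)).selmerGroup * B) :
    Finite ↥(GreenbergVatsal2000.datumStrictSelmer U (↥(W.geomTorsion (p : ℤ))) p
        (AcSelmer.bdpData _ p 𝔭') (↑S₀ : Set (HeightOneSpectrum (𝓞 K)))) ∧
    Nat.card ↥(GreenbergVatsal2000.datumStrictSelmer U (↥(W.geomTorsion (p : ℤ))) p
        (AcSelmer.bdpData _ p 𝔭') (↑S₀ : Set (HeightOneSpectrum (𝓞 K)))) *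
      Nat.card (↥(W.selmerTorsionOver U (p : ℤ)) ⧸
        (⨅ σ : absoluteGaloisGroup K,
          (AddMonoidHom.ker (resOfLe (↥(W.geomTorsion (p : ℤ))) (inf_le_left : U ⊓ decomp 𝔭 ≤ U))).comap
            (conjH1 U (↥(W.geomTorsion (p : ℤ))) σ)).addSubgroupOf (W.selmerTorsionOver U (p : ℤ))) *
      Nat.card (↥(W.selmerTorsionOver U (p : ℤ)) ⧸
        (⨅ σ : absoluteGaloisGroup K,
          (AddMonoidHom.ker (resOfLe (↥(W.geomTorsion (p : ℤ))) (inf_le_left : U ⊓ decomp 𝔭' ≤ U))).comap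
            (conjH1 U (↥(W.geomTorsion (p : ℤ))) σ)).addSubgroupOf (W.selmerTorsionOver U (p : ℤ))) ≤
      Nat.card ↥(W.selmerTorsionOver U (p : ℤ)) * B := by
  obtain ⟨hRfin, hR⟩ := finite_and_natCard_datumStrictSelmer_le W p L U ΦM Φ hΦ hbij hdict hkum 𝔭 𝔭' h𝔭' S₀ hsplit
    hgood hIU P T P' (fun w h ↦ (hP w).mpr h) (fun w h ↦ (hT w).mpr h) (fun w h ↦ (hP' w).mp h)
  have hQ := natCard_selmerTorsionOver_quotient_le W p L U ΦM Φ hΦ hbij hdict hkum hL 𝔭 P hP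
  have hQ' := natCard_selmerTorsionOver_quotient_le W p L U ΦM Φ hΦ hbij hdict hkum hL 𝔭' P' hP'
  have hT1 := natCard_kummerRelaxed_inl_le_selmerTorsionOver W p L U ΦM Φ hΦ hbij hkum hL hK
  exact ⟨hRfin, le_trans (le_trans (Nat.mul_le_mul (Nat.mul_le_mul hR hQ) hQ') hPT) (Nat.mul_le_mul_right _ hT1)⟩

end Summit.BirchSwinnertonDyer.BirchSwinnertonDyer.Theorems.UniversalToricDescentResidualLinkTransport

end
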